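import Literature.RingTheory.RegularLocalRing.SopRegular
import HarnessLib

/-!
# Colon capturing for `R = S/Q`, step CC2b: lifting a system of parameters of `S/Q`

Let `(S, 𝔪)` be a Noetherian local ring, `Q` a prime ideal, `y₁, …, y_h ∈ Q` with
`dim S/(y) = d`, and `x₀ : Fin d → S` representatives of `d` elements of `R = S/Q` generating an
ideal with maximal radical (a system of parameters of `R` when `dim R = d`).  We produce lifts
`x ≡ x₀ (mod Q)` such that `(y, x)` has maximal radical in `S` (Hochster–Huneke, proof of
Thm. 4.2 (c) of *F-regularity, test elements, and smooth base change*, 1994: the reduction of colon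
capturing in `S/Q` to colon capturing in `S`).

Proof.  Induction on `k ≤ d` with the invariant `dim S/J_k ≤ d - k`,
`J_k = (y) + (x₁, …, x_k)`.  For the step, `x_{k+1} = x₀_{k+1} + q` with `q ∈ Q` chosen by coset
prime avoidance (E. Davis) outside the minimal primes of `J_k` not containing `Q`
(`colonCapturing_exists_lifts_coset_avoid`); a minimal prime `P ⊇ Q` of `J_k` containing `x_{k+1}`
contains `x₀_1, …, x₀_{k+1}`, so `S/P` is a local ring in which the images of the remaining
`d - k - 1` parameters generate an `𝔪`-primary ideal, whence `dim S/P ≤ d - k - 1`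
(`colonCapturing_exists_lifts_dim_quotient_le`).  Every minimal prime of `J_{k+1}` then has
coheight `≤ d - k - 1` (`colonCapturing_exists_lifts_step`: a proper inclusion of primes drops the
coheight).  At `k = d`, `dim S/J_d ≤ 0` and `J_d ≤ 𝔪` force `rad J_d = 𝔪`
(`colonCapturing_exists_lifts_radical_isMaximal`).
-/

-- single-problem summit: the doubled namespace component is forced
set_option linter.dupNamespace false

noncomputable section

open IsLocalRing

namespace Summit.ResolutionOfSingularities.ResolutionOfSingularities.Theorems.FRationalResolution

/-- **Coset prime avoidance** (E. Davis): if the ideal `Q` is contained in none of the finitely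
many primes `P ∈ T`, then every coset `a + Q` meets the complement of `⋃ P`. -/
theorem colonCapturing_exists_lifts_coset_avoid {S : Type*} [CommRing S] (Q : Ideal S)
    (T : Finset (Ideal S)) (hT : ∀ P ∈ T, P.IsPrime) (hQ : ∀ P ∈ T, ¬ Q ≤ P) (a : S) :
    ∃ q ∈ Q, ∀ P ∈ T, a + q ∉ P := by
  classical
  induction T using Finset.strongInduction with
  | H T ih =>
    rcases T.eq_empty_or_nonempty with rfl | hne
    · exact ⟨0, Q.zero_mem, fun P hP => absurd hP (Finset.notMem_empty P)⟩
    obtain ⟨P, hP⟩ := T.exists_minimal hne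
    have hPT : P ∈ T := hP.1
    obtain ⟨q', hq'Q, hq'⟩ := ih (T.erase P) (Finset.erase_ssubset hPT)
      (fun P' hP' => hT P' (Finset.mem_of_mem_erase hP'))
      (fun P' hP' => hQ P' (Finset.mem_of_mem_erase hP'))
    by_cases haP : a + q' ∈ P
    · -- pick `r ∈ Q ∩ ⋂ (T ∖ {P})` outside `P` and use `q' + r`
      have hPp : P.IsPrime := hT P hPT
      have hnle : ¬ (Q ⊓ (T.erase P).inf id ≤ P) := by
        intro hle
        rcases hPp.inf_le.mp hle with h | h
        · exact hQ P hPT h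
        · obtain ⟨P', hP'T, hP'le⟩ := hPp.inf_le'.mp h
          exact (Finset.mem_erase.mp hP'T).1
            (le_antisymm hP'le (hP.2 (Finset.mem_of_mem_erase hP'T) hP'le))
      obtain ⟨r, hr, hrP⟩ := SetLike.not_le_iff_exists.mp hnle
      obtain ⟨hrQ, hrT⟩ := Ideal.mem_inf.mp hr
      refine ⟨q' + r, Q.add_mem hq'Q hrQ, fun P' hP'T => ?_⟩
      by_cases hP'P : P' = P
      · rw [hP'P]
        intro h
        apply hrP
        have e : r = (a + (q' + r)) - (a + q') := by ring
        rw [e]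
        exact P.sub_mem h haP
      · have hP'e : P' ∈ T.erase P := Finset.mem_erase.mpr ⟨hP'P, hP'T⟩
        intro h
        apply hq' P' hP'e
        have hrP' : r ∈ P' := (Finset.inf_le (f := id) hP'e : (T.erase P).inf id ≤ P') hrT
        have e : a + q' = (a + (q' + r)) - r := by ring
        rw [e]
        exact P'.sub_mem h hrP'
    · refine ⟨q', hq'Q, fun P' hP'T => ?_⟩
      by_cases hP'P : P' = P
      · rw [hP'P]
        exact haP
      · exact hq' P' (Finset.mem_erase.mpr ⟨hP'P, hP'T⟩)

/-- `dim S/J ≤ n` as soon as `dim S/P ≤ n` for every minimal prime `P` of `J`: a chain of primes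
above `J` is a chain above a minimal prime of `J` contained in its first member. -/
theorem colonCapturing_exists_lifts_dim_le_of_minimalPrimes {S : Type*} [CommRing S]
    (J : Ideal S) {n : WithBot ℕ∞} (h : ∀ P ∈ J.minimalPrimes, ringKrullDim (S ⧸ P) ≤ n) :
    ringKrullDim (S ⧸ J) ≤ n := by
  rw [ringKrullDim_quotient, Order.krullDim]
  refine iSup_le fun l => ?_
  have hJl : J ≤ l.head.1.asIdeal := fun r hr => l.head.2 hr
  obtain ⟨p, hp, hp'⟩ := Ideal.exists_minimalPrimes_le hJl
  have hmem : ∀ i, (l i).1 ∈ PrimeSpectrum.zeroLocus (R := S) p := fun i => by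
    rw [PrimeSpectrum.mem_zeroLocus, SetLike.coe_subset_coe]
    exact hp'.trans ((PrimeSpectrum.asIdeal_le_asIdeal _ _).mpr
      (Subtype.coe_le_coe.mpr (l.head_le i)))
  let l' : LTSeries (PrimeSpectrum.zeroLocus (R := S) p) :=
    LTSeries.mk l.length (fun i => ⟨(l i).1, hmem i⟩) fun i j hij => l.strictMono hij
  have h1 : (l.length : WithBot ℕ∞) = l'.length := rfl
  rw [h1]
  refine (Order.LTSeries.length_le_krullDim l').trans ?_
  rw [← ringKrullDim_quotient]
  exact h p hp

/-- One step of the construction: if `dim S/J ≤ n + 1` and `a` lies in no minimal prime `P` of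
`J` with `dim S/P = n + 1`, then `dim S/(J + (a)) ≤ n` (a minimal prime `P''` of `J + (a)` contains
a minimal prime `P'` of `J`; if `a ∉ P'` then `P' < P''` and the coheight drops, the image of `a`
in the domain `S/P'` being a non-zero-divisor). -/
theorem colonCapturing_exists_lifts_step {S : Type*} [CommRing S] [IsLocalRing S]
    [IsNoetherianRing S] (J : Ideal S) (a : S) (n : ℕ)
    (hJ : ringKrullDim (S ⧸ J) ≤ (n + 1 : ℕ))
    (ha : ∀ P ∈ J.minimalPrimes, a ∈ P → ringKrullDim (S ⧸ P) ≤ n) :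
    ringKrullDim (S ⧸ (J ⊔ Ideal.span {a})) ≤ n := by
  refine colonCapturing_exists_lifts_dim_le_of_minimalPrimes _ fun P'' hP'' => ?_
  haveI hP''p : P''.IsPrime := hP''.1.1
  have hJP'' : J ⊔ Ideal.span {a} ≤ P'' := hP''.1.2
  have haP'' : a ∈ P'' := hJP'' (Ideal.mem_sup_right (Ideal.mem_span_singleton_self a))
  obtain ⟨P', hP', hP'le⟩ := Ideal.exists_minimalPrimes_le (le_sup_left.trans hJP'' : J ≤ P'')
  haveI hP'p : P'.IsPrime := hP'.1.1
  by_cases haP' : a ∈ P'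
  · exact (ringKrullDim_le_of_surjective (Ideal.Quotient.factor hP'le)
      (Ideal.Quotient.factor_surjective hP'le)).trans (ha P' hP' haP')
  -- otherwise `P' < P''` and `dim S/P'' + 1 ≤ dim (S/P')/(ā) + 1 ≤ dim S/P' ≤ n + 1`
  have hr0 : Ideal.Quotient.mk P' a ≠ 0 := mt Ideal.Quotient.eq_zero_iff_mem.mp haP'
  have h1 := ringKrullDim_quotient_succ_le_of_nonZeroDivisor (mem_nonZeroDivisors_of_ne_zero hr0)
  have hle : Ideal.span {Ideal.Quotient.mk P' a} ≤ P''.map (Ideal.Quotient.mk P') := by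
    rw [Ideal.span_singleton_le_iff_mem]
    exact Ideal.mem_map_of_mem _ haP''
  have h2 : ringKrullDim (S ⧸ P'') ≤
      ringKrullDim ((S ⧸ P') ⧸ Ideal.span {Ideal.Quotient.mk P' a}) := by
    rw [← ringKrullDim_eq_of_ringEquiv (DoubleQuot.quotQuotEquivQuotOfLE hP'le)]
    exact ringKrullDim_le_of_surjective (Ideal.Quotient.factor hle)
      (Ideal.Quotient.factor_surjective hle)
  have h3 : ringKrullDim (S ⧸ P') ≤ (n + 1 : ℕ) :=
    (ringKrullDim_le_of_surjective (Ideal.Quotient.factor hP'.1.2)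
      (Ideal.Quotient.factor_surjective _)).trans hJ
  haveI := Literature.AlgebraicGeometry.Resolution.isLocalRing_quotient hP''p.ne_top
  obtain ⟨e, he⟩ :=
    Literature.AlgebraicGeometry.Resolution.exists_nat_cast_eq_ringKrullDim (R := S ⧸ P'')
  rw [he] at h2 ⊢
  have h4 : e + 1 ≤ n + 1 := by exact_mod_cast ((add_le_add h2 le_rfl).trans h1).trans h3
  exact_mod_cast (by omega : e ≤ n)

/-- The representatives `x₀ i` of elements generating an ideal with maximal (hence proper)
radical in `S/Q` are non-units, i.e. lie in the maximal ideal of `S`. -/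
theorem colonCapturing_exists_lifts_mem_maximalIdeal {S : Type*} [CommRing S] [IsLocalRing S]
    (Q : Ideal S) {d : ℕ} (x₀ : Fin d → S)
    (hx₀ : (Ideal.span (Set.range (fun i => Ideal.Quotient.mk Q (x₀ i)))).radical.IsMaximal)
    (i : Fin d) : x₀ i ∈ maximalIdeal S := by
  rw [IsLocalRing.mem_maximalIdeal, mem_nonunits_iff]
  intro hu
  exact hx₀.ne_top (Ideal.eq_top_of_isUnit_mem _
    (Ideal.le_radical (Ideal.subset_span ⟨i, rfl⟩)) (hu.map (Ideal.Quotient.mk Q)))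

/-- If the images of `x₀ : Fin d → S` generate an ideal with maximal radical in `S/Q` and a prime
`P ⊇ Q` contains `x₀ j` for all `j < k` (`k ≤ d`), then `dim S/P ≤ d - k`: the images in the
local ring `S/P` of the remaining `d - k` elements generate an `𝔪`-primary ideal. -/
theorem colonCapturing_exists_lifts_dim_quotient_le (S : Type*) [CommRing S] [IsLocalRing S]
    [IsNoetherianRing S] (Q : Ideal S) [Q.IsPrime] {d : ℕ} (x₀ : Fin d → S)
    (hx₀ : (Ideal.span (Set.range (fun i => Ideal.Quotient.mk Q (x₀ i)))).radical.IsMaximal)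
    {P : Ideal S} [hP : P.IsPrime] (hQP : Q ≤ P) {k : ℕ} (hk : k ≤ d)
    (hxP : ∀ j : Fin d, j.val < k → x₀ j ∈ P) :
    ringKrullDim (S ⧸ P) ≤ (d - k : ℕ) := by
  haveI : IsLocalRing (S ⧸ Q) :=
    Literature.AlgebraicGeometry.Resolution.isLocalRing_quotient (Ideal.IsPrime.ne_top ‹_›)
  haveI : IsLocalRing (S ⧸ P) :=
    Literature.AlgebraicGeometry.Resolution.isLocalRing_quotient hP.ne_top
  -- `𝔪_{S/Q} ^ N ≤ (x̄₀)`
  have hmI : maximalIdeal (S ⧸ Q) ≤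
      (Ideal.span (Set.range (fun i => Ideal.Quotient.mk Q (x₀ i)))).radical :=
    (IsLocalRing.eq_maximalIdeal hx₀).symm.le
  obtain ⟨N, hN⟩ := Ideal.exists_pow_le_of_le_radical_of_fg hmI (IsNoetherian.noetherian _)
  -- the images in `S/P` of the remaining elements
  obtain ⟨L, hL⟩ : ∃ L : List (S ⧸ P),
      L = List.ofFn fun t : Fin (d - k) => Ideal.Quotient.mk P (x₀ ⟨k + t.val, by omega⟩) :=
    ⟨_, rfl⟩
  have hlen : L.length = d - k := by rw [hL, List.length_ofFn]
  rw [← hlen]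
  refine Literature.RingTheory.RegularLocalRing.ringKrullDim_le_length_of_maximalIdeal_pow_le
    (R := S ⧸ P) (L := L) (fun r hr => ?_) (N := N) ?_
  · rw [hL, List.mem_ofFn] at hr
    obtain ⟨t, rfl⟩ := hr
    rw [← map_maximalIdeal_of_surjective (Ideal.Quotient.mk P) Ideal.Quotient.mk_surjective]
    exact Ideal.mem_map_of_mem _ (colonCapturing_exists_lifts_mem_maximalIdeal Q x₀ hx₀ _)
  · rw [← map_maximalIdeal_of_surjective (Ideal.Quotient.factor hQP)
      (Ideal.Quotient.factor_surjective hQP), ← Ideal.map_pow]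
    refine (Ideal.map_mono hN).trans ?_
    rw [Ideal.map_span, Ideal.span_le]
    rintro _ ⟨_, ⟨j, rfl⟩, rfl⟩
    rw [Ideal.Quotient.factor_mk, SetLike.mem_coe]
    by_cases hj : j.val < k
    · rw [Ideal.Quotient.eq_zero_iff_mem.mpr (hxP j hj)]
      exact Ideal.zero_mem _
    · refine Ideal.subset_span ?_
      rw [Set.mem_setOf_eq, hL, List.mem_ofFn]
      refine ⟨⟨j.val - k, by omega⟩, ?_⟩
      congr 2
      exact Fin.ext (show k + (j.val - k) = j.val by omega)

/-- In a local ring, a proper ideal `J` with `dim S/J ≤ 0` has radical `𝔪`: the minimal primes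
of `J` are maximal. -/
theorem colonCapturing_exists_lifts_radical_isMaximal {S : Type*} [CommRing S] [IsLocalRing S]
    {J : Ideal S} (hJ : J ≠ ⊤) (hdim : ringKrullDim (S ⧸ J) ≤ 0) : J.radical.IsMaximal := by
  have h0 : Ring.KrullDimLE 0 (S ⧸ J) := Ring.krullDimLE_iff.mpr (by exact_mod_cast hdim)
  have hmax := Ideal.krullDimLE_zero_quotient_iff_forall_minimalPrimes_isMaximal.mp h0
  have hrad : J.radical = maximalIdeal S := by
    refine le_antisymm (IsLocalRing.le_maximalIdeal fun h => hJ (Ideal.radical_eq_top.mp h)) ?_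
    rw [Ideal.radical_eq_sInf]
    refine le_sInf fun P hP => ?_
    obtain ⟨hJP, hPp⟩ := hP
    haveI : P.IsPrime := hPp
    obtain ⟨P₀, hP₀, hP₀P⟩ := Ideal.exists_minimalPrimes_le hJP
    rw [← IsLocalRing.eq_maximalIdeal (hmax P₀ hP₀)]
    exact hP₀P
  rw [hrad]
  exact maximalIdeal.isMaximal S

/-- **Colon capturing for `R = S/Q`, step CC2b** (Hochster–Huneke 1994, proof of Thm. 4.2 (c)):
given `y₁, …, y_h ∈ Q` with `dim S/(y) = d` and representatives `x₀` of `d` elements of `S/Q`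
generating an ideal with maximal radical, there are lifts `x ≡ x₀ (mod Q)` such that `(y, x)`
has maximal radical in `S` (so `(y, x)` is a system of parameters of `S` when `h + d = dim S`). -/
theorem colonCapturing_exists_lifts (S : Type) [CommRing S] [IsLocalRing S] [IsNoetherianRing S]
    (Q : Ideal S) [Q.IsPrime] {d h : ℕ} (y : Fin h → S) (hy : ∀ j, y j ∈ Q)
    (hyd : ringKrullDim (S ⧸ Ideal.span (Set.range y)) = d) (hQd : ringKrullDim (S ⧸ Q) = d)
    (x₀ : Fin d → S)
    (hx₀ : (Ideal.span (Set.range (fun i => Ideal.Quotient.mk Q (x₀ i)))).radical.IsMaximal) :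
    ∃ x : Fin d → S, (∀ i, x i - x₀ i ∈ Q) ∧
      (Ideal.span (Set.range y ∪ Set.range x)).radical.IsMaximal := by
  have _ := hQd -- registered hypothesis `dim S/Q = d`; the lifting itself does not need it
  -- the inductive construction of `x₁, …, x_k` with `dim S/((y) + (x₁, …, x_k)) ≤ d - k`
  have key : ∀ k (hk : k ≤ d), ∃ x : Fin k → S, (∀ j, x j - x₀ (Fin.castLE hk j) ∈ Q) ∧
      ringKrullDim (S ⧸ (Ideal.span (Set.range y) ⊔ Ideal.span (Set.range x))) ≤ (d - k : ℕ) := by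
    intro k
    induction k with
    | zero =>
      intro hk
      refine ⟨fun j => x₀ (Fin.castLE hk j), fun j => by rw [sub_self]; exact Q.zero_mem, ?_⟩
      rw [Nat.sub_zero, ← hyd]
      exact ringKrullDim_le_of_surjective (Ideal.Quotient.factor le_sup_left)
        (Ideal.Quotient.factor_surjective _)
    | succ k ih =>
      intro hk
      obtain ⟨x, hxQ, hdim⟩ := ih (Nat.le_of_succ_le hk)
      -- the minimal primes of `J_k` not containing `Q`, to be avoided
      have hfin : {P ∈ (Ideal.span (Set.range y) ⊔ Ideal.span (Set.range x)).minimalPrimes |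
          ¬ Q ≤ P}.Finite :=
        (Ideal.finite_minimalPrimes_of_isNoetherianRing S _).subset (Set.sep_subset _ _)
      obtain ⟨q, hqQ, hq⟩ := colonCapturing_exists_lifts_coset_avoid Q hfin.toFinset
        (fun P hP => by
          obtain ⟨hPmin, -⟩ := (Set.Finite.mem_toFinset _).mp hP
          exact hPmin.1.1)
        (fun P hP => ((Set.Finite.mem_toFinset _).mp hP).2) (x₀ (Fin.castLE hk (Fin.last k)))
      refine ⟨Fin.snoc x (x₀ (Fin.castLE hk (Fin.last k)) + q), fun j => ?_, ?_⟩
      · -- congruence modulo `Q`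
        induction j using Fin.lastCases with
        | last => rw [Fin.snoc_last, add_sub_cancel_left]; exact hqQ
        | cast j =>
          rw [Fin.snoc_castSucc]
          have e : Fin.castLE hk (Fin.castSucc j) = Fin.castLE (Nat.le_of_succ_le hk) j :=
            Fin.ext rfl
          rw [e]
          exact hxQ j
      · -- the dimension bound for `J_{k+1} = J_k + (x_{k+1})`
        rw [Fin.range_snoc, Ideal.span_insert, sup_left_comm, sup_comm]
        have hdk : d - k = d - (k + 1) + 1 := by omega
        rw [hdk] at hdim
        refine colonCapturing_exists_lifts_step _ _ (d - (k + 1)) hdim fun P hP haP => ?_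
        haveI : P.IsPrime := hP.1.1
        have hJP : Ideal.span (Set.range y) ⊔ Ideal.span (Set.range x) ≤ P := hP.1.2
        by_cases hQP : Q ≤ P
        · refine colonCapturing_exists_lifts_dim_quotient_le S Q x₀ hx₀ hQP hk fun j hj => ?_
          by_cases hjk : j.val < k
          · have hcast : Fin.castLE (Nat.le_of_succ_le hk) ⟨j.val, hjk⟩ = j := Fin.ext rfl
            have hxj : x ⟨j.val, hjk⟩ ∈ P :=
              hJP (Ideal.mem_sup_right (Ideal.subset_span ⟨⟨j.val, hjk⟩, rfl⟩))
            have h2 : x ⟨j.val, hjk⟩ - x₀ j ∈ P := by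
              have := hQP (hxQ ⟨j.val, hjk⟩)
              rwa [hcast] at this
            have e : x₀ j = x ⟨j.val, hjk⟩ - (x ⟨j.val, hjk⟩ - x₀ j) := by ring
            rw [e]
            exact P.sub_mem hxj h2
          · have hjeq : j = Fin.castLE hk (Fin.last k) :=
              Fin.ext (by simp only [Fin.val_castLE, Fin.val_last]; omega)
            have e : x₀ j = (x₀ (Fin.castLE hk (Fin.last k)) + q) - q := by
              rw [hjeq, add_sub_cancel_right]
            rw [e]
            exact P.sub_mem haP (hQP hqQ)
        · exact absurd haP (hq P ((Set.Finite.mem_toFinset _).mpr ⟨hP, hQP⟩))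
  obtain ⟨x, hxQ, hdim⟩ := key d le_rfl
  have hxQ' : ∀ i, x i - x₀ i ∈ Q := fun i => by
    have := hxQ i
    rwa [show Fin.castLE (le_refl d) i = i from Fin.ext rfl] at this
  refine ⟨x, hxQ', ?_⟩
  rw [Ideal.span_union]
  rw [Nat.sub_self, Nat.cast_zero] at hdim
  refine colonCapturing_exists_lifts_radical_isMaximal (fun htop => ?_) hdim
  have hle : Ideal.span (Set.range y) ⊔ Ideal.span (Set.range x) ≤ maximalIdeal S := by
    refine sup_le (Ideal.span_le.mpr ?_) (Ideal.span_le.mpr ?_)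
    · rintro _ ⟨j, rfl⟩
      exact IsLocalRing.le_maximalIdeal (Ideal.IsPrime.ne_top ‹_›) (hy j)
    · rintro _ ⟨i, rfl⟩
      have e : x i = (x i - x₀ i) + x₀ i := by ring
      rw [SetLike.mem_coe, e]
      exact (maximalIdeal S).add_mem (IsLocalRing.le_maximalIdeal (Ideal.IsPrime.ne_top ‹_›)
        (hxQ' i)) (colonCapturing_exists_lifts_mem_maximalIdeal Q x₀ hx₀ i)
  exact (maximalIdeal.isMaximal S).ne_top (top_le_iff.mp (htop ▸ hle))

end Summit.ResolutionOfSingularities.ResolutionOfSingularities.Theorems.FRationalResolution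

end
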